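import Summits.QuantumFields.YangMills.Theses.LangevinControlUV
import Summits.QuantumFields.YangMills.Theorems.FemtoCurvatureTwoPoint.Negative.PlaquetteFreezing
import Summits.QuantumFields.YangMills.Theorems.FemtoCurvatureTwoPoint.Negative.ForcedDividend
import Summits.QuantumFields.YangMills.Theorems.FemtoCurvatureTwoPoint.Negative.UpperOnly
import Summits.QuantumFields.YangMills.Theorems.FemtoCurvatureTwoPoint.Negative.UnfaithfulFalseSU
import Summits.QuantumFields.YangMills.Theorems.FemtoCurvatureTwoPoint.Negative.FiniteGroupFalse

/-!
# Disproof of `FemtoCurvatureTwoPointC` — standing adversary file (cdisprove, cycle 1)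

Crux item `stmt-QuantumFields-16204`, decl
`Summit.QuantumFields.YangMills.Theses.LangevinControlUV.FemtoCurvatureTwoPointC`
(route `LangevinControlUV`, repair C′ of the typed item `FemtoCurvatureTwoPoint`, stmt-9363):
for every compact simple Lie `G` and faithful unitary `r` there are a CONTINUOUS unit map `a > 0`,
`a → 0`, a shape `Γ ∈ (0, 1]` on `(0, ℓ₀]` and `β₀, ℓ₀, c > 0, C` such that on every femto torus
(`L · a(β) ≤ ℓ₀`, `β ≥ β₀`): (1) `c Γ(n a) ≤ n⁸ Cov(P_0^{01}, P_{ne₂}^{01}) ≤ C Γ(n a)` for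
`1 ≤ n ≤ L/8`; (2) `|Cov(P_x^{ij}, P_y^{i'j'})| dist⁸ ≤ C Γ(dist · a)` for `x ≠ y`.
The ONLY difference to the typed predecessor is the token `Continuous a`.

## Findings (index; every `theorem` below is sorry-free)

* `§ Defs`, `femtoCurvatureTwoPointC_iff` (`Iff.rfl`): the crux is
  `∀ G simple compact, ∀ r, PackageCRho r.ρ` with
  `PackageCRho ρ := ∃ a, Continuous a ∧ ∃ Γ β₀ ℓ₀ c C, PackageWith ρ a Γ β₀ ℓ₀ c C` and `PackageWith`
  VERBATIM the predecessor's body (`Cruxes/FemtoCurvatureTwoPoint/Disproof.lean § Defs`), so every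
  landed `Theorems/FemtoCurvatureTwoPoint/Negative/*` lemma applies to C′ data unchanged.
* `§ Inherited` (load-bearing hypotheses carried over, each a 3-line transfer through
  "C′-witness ⇒ typed witness"): `femtoCurvatureTwoPoint_of_C` (the edge), `unfaithfulC_false`
  (faithfulness of `r` load-bearing: the bare-`ρ` variant of C′ is FALSE, witness `SU(2)`, `ρ = 1`;
  from `Negative.UnfaithfulFalseSU`), `nontrivialC_false` (`ConnectedSpace G` load-bearing: C′ with
  `IsCompactSimpleLieGroup G` weakened to `Nontrivial G` is FALSE, witness `ℤ₂`; from
  `Negative.FiniteGroupFalse`), `no_shape_floorC` (no witness has `Γ ≥ γ₀ > 0` on `(0, ℓ₀]`; from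
  `Negative.ForcedDividend`).
* `§ Running` (NEW — what the token `Continuous a` makes load-bearing, kernel-checked):
  `exists_ge_level` / `tendsto_atTop_of_levels` (levels `s/n` of a continuous unit map are attained,
  at couplings `β_n → ∞`), `PackageWith.exists_chain` (**RG chains**: for every small `s` and every
  `n ≥ 1` a coupling `β_n(s) ≥ β₀` with `n a(β_n) = s`, torus `8n` femto, and
  `c Γ(s) ≤ n⁸ Cov_{8n,β_n}(n) ≤ C Γ(s)` — ONE value of `Γ` for the whole chain),
  `PackageWith.chain_tendsto` (`β_n(s) → ∞`: the de-freezing couplings of the tori `8n` diverge —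
  dimensional transmutation is FORCED), and the kill switch
  `PackageWith.not_uniformDiagonalFreezing`: **C′ is incompatible with ANY freezing of the diagonal
  femto amplitudes `n⁸ Cov_{8n,β}(n) ≤ φ(β) → 0` that is UNIFORM in `n`** — in particular with the
  bare-coupling law `n⁸ Cov_{8n,β}(n) ≤ K β⁻²` of every Gaussian / abelian theory (compact `U(1)`:
  free Maxwell around torons). So any proof of C′ must USE running (the amplitude in units of the
  bare coupling must be unbounded along the chains, `β_n² · n⁸Cov_{8n,β_n}(n) → ∞`), i.e. asymptotic
  freedom — the content the typed item lacked (there a generic STEP unit map decouples all `(β, n)`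
  and compact `U(1)` passes, `CDISPROVE-gen2-verdict.md`). Templates:
  `not_packageCRho_of_uniformDiagonalFreezing`, `not_packageCRho_of_bareLaw` (`K β⁻²` suffices),
  `femtoCurvatureTwoPointC_false_of_uniformFreezing_su`.
* `§ UpperOnlyC` (tightness, NEW): `exists_continuous_majorant` (analysis: every positive function
  `σ ≤ 1` with `σ → 0` has a CONTINUOUS majorant `→ 0`), `exists_upperOnlyC` — **C′ with its LOWER
  bound deleted is a THEOREM** for every compact `G` and continuous unitary `ρ` (`Γ ≡ 1`, `C = 1`,
  continuous slow unit map): continuity costs nothing on the upper side; the lower bound ALONG RG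
  CHAINS is the unique content. `forallA_false` — the `∀ a`-strengthening ("EVERY continuous unit map
  carries some package") is FALSE for every `G, ρ`: a continuous unit map decaying slowly enough
  (thresholds from freezing) carries none — continuity alone does not pin `a`, two-sidedness along
  chains does.
* `§ Resists` (end of file): why no kill of C′ is in reach and what a kill must look like; what C′
  really encodes (asymptotic freedom as a two-sided STEP INEQUALITY for an intrinsic box coupling plus
  `O(1)` amplitude matching — NOT loop-exact asymptotic scaling; correction of the gen-2 pinning remark).
* LANDED extracts (importable, `Theorems/FemtoCurvatureTwoPointC/Negative/`): `UniformFreezing`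
  (p123015, ACCEPTED: `false_of_uniformFreezing`, `lowerBoundC_false_of_uniformFreezing`,
  `femtoCurvatureTwoPointC_false_of_uniformFreezing`, `…_of_bareLaw_su`, `exists_ge_level`,
  `tendsto_atTop_of_levels`), `UpperOnlyC` (p123081: `exists_continuous_majorant`, `exists_parasitic`,
  `exists_upperOnlyC(_rep)`, `forallA_lowerBound_false`).
-/

noncomputable section

open scoped Matrix
open Filter Topology MeasureTheory Set
open Literature.MathematicalPhysics.QuantumFieldTheory Literature.MathematicalPhysics.QuantumLattice
open Summit.QuantumFields.YangMills.Theses.LangevinControlUV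
  (FemtoCurvatureTwoPointC FemtoCurvatureTwoPoint)
open Summit.QuantumFields.YangMills.Theorems.TunedSequenceExists.Negative.Freezing
  (secondCountable_of_latticeRep)
open Summit.QuantumFields.YangMills.Theorems.FemtoCurvatureTwoPoint.Negative

namespace Summit.QuantumFields.YangMills.Cruxes.FemtoCurvatureTwoPointC.Disproof

/-! ## § Defs — the crux body, unbundled at a fixed group and bare representation -/

section Defs

variable {G : Type} [Group G] [TopologicalSpace G] [IsTopologicalGroup G] [CompactSpace G]
  [MeasurableSpace G] [BorelSpace G] {N : ℕ}

/-- The plaquette field `P_x^{ij}(U) = N - Re tr ρ(U_{p(x;i,j)})` (the crux's `let P`). -/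
def plaq (ρ : G →* Matrix (Fin N) (Fin N) ℂ) {L : ℕ} (x : Site 4 L) (i j : Fin 4)
    (U : GaugeConfig 4 L G) : ℝ :=
  (N : ℝ) - (ρ (plaquetteHolonomy U x i j)).trace.re

/-- Covariance under Wilson's measure (the crux's `let cov`, `let E`). -/
def cov (ρ : G →* Matrix (Fin N) (Fin N) ℂ) {L : ℕ} [NeZero L] (β : ℝ)
    (F F' : GaugeConfig 4 L G → ℝ) : ℝ :=
  wilsonExpectation (d := 4) (L := L) ρ β (fun U => F U * F' U) -
    wilsonExpectation (d := 4) (L := L) ρ β F * wilsonExpectation (d := 4) (L := L) ρ β F'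

/-- Torus Euclidean distance (the crux's `let dist`). -/
def tdist {L : ℕ} (x y : Site 4 L) : ℝ :=
  Real.sqrt (∑ k : Fin 4, (((x k - y k).valMinAbs : ℤ) : ℝ) ^ 2)

/-- The reference axis covariance `Cov(P_0^{01}, P_{n e₂}^{01})` on the torus of side `L`. -/
def axisCov (ρ : G →* Matrix (Fin N) (Fin N) ℂ) (L : ℕ) [NeZero L] (β : ℝ) (n : ℕ) : ℝ :=
  cov ρ β (plaq ρ (0 : Site 4 L) 0 1) (plaq ρ (Pi.single (2 : Fin 4) ((n : ℕ) : ZMod L)) 0 1)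

/-- The two clauses of the crux on ONE torus at ONE coupling, for data `(a, Γ, c, C)`. -/
def Clauses (ρ : G →* Matrix (Fin N) (Fin N) ℂ) (a Γ : ℝ → ℝ) (c C : ℝ) (L : ℕ) [NeZero L]
    (β : ℝ) : Prop :=
  (∀ n : ℕ, 1 ≤ n → 8 * n ≤ L →
      c * Γ ((n : ℝ) * a β) ≤ (n : ℝ) ^ 8 * axisCov ρ L β n ∧
        (n : ℝ) ^ 8 * axisCov ρ L β n ≤ C * Γ ((n : ℝ) * a β)) ∧
    ∀ (x y : Site 4 L) (i j i' j' : Fin 4), x ≠ y → i ≠ j → i' ≠ j' →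
      |cov ρ β (plaq ρ x i j) (plaq ρ y i' j')| * tdist x y ^ 8 ≤ C * Γ (tdist x y * a β)

/-- The package for a bare representation `ρ` with explicit data `(a, Γ, β₀, ℓ₀, c, C)`:
side conditions and the clauses on every femto torus — VERBATIM the typed predecessor's body. -/
def PackageWith (ρ : G →* Matrix (Fin N) (Fin N) ℂ) (a Γ : ℝ → ℝ) (β₀ ℓ₀ c C : ℝ) : Prop :=
  0 < ℓ₀ ∧ 0 < c ∧ (∀ β, 0 < a β) ∧ Tendsto a atTop (𝓝 0) ∧
    (∀ s : ℝ, 0 < s → s ≤ ℓ₀ → 0 < Γ s ∧ Γ s ≤ 1) ∧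
      ∀ (L : ℕ) [NeZero L] (β : ℝ), β₀ ≤ β → (L : ℝ) * a β ≤ ℓ₀ → Clauses ρ a Γ c C L β

/-- The C′ crux AT a fixed compact group and bare representation `ρ`: a CONTINUOUS unit map
carrying the package. -/
def PackageCRho (ρ : G →* Matrix (Fin N) (Fin N) ℂ) : Prop :=
  ∃ (a : ℝ → ℝ), Continuous a ∧ ∃ (Γ : ℝ → ℝ) (β₀ ℓ₀ c C : ℝ), PackageWith ρ a Γ β₀ ℓ₀ c C

end Defs

/-- The crux is literally `∀ G simple compact, ∀ r : LatticeRep G, PackageCRho r.ρ`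
(definitional unbundling; Borel σ-algebra as in the crux). -/
theorem femtoCurvatureTwoPointC_iff :
    FemtoCurvatureTwoPointC ↔
      ∀ (G : Type) [Group G] [TopologicalSpace G] [IsTopologicalGroup G] [CompactSpace G],
        IsCompactSimpleLieGroup G →
          letI : MeasurableSpace G := borel G
          haveI : BorelSpace G := ⟨rfl⟩
          ∀ r : LatticeRep G, PackageCRho r.ρ :=
  Iff.rfl

/-! ## § Inherited — the C′ witness is a typed witness; load-bearing hypotheses carried over -/

section Inherited

/-- **The C′ edge** (also landed as `Theorems/…FemtoCurvatureTwoPointOfC`): forgetting continuity,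
a C′ witness is a witness of the typed item. -/
theorem femtoCurvatureTwoPoint_of_C (hC : FemtoCurvatureTwoPointC) : FemtoCurvatureTwoPoint := by
  intro G _ _ _ _ hG r
  obtain ⟨a, -, h⟩ := hC G hG r
  exact ⟨a, h⟩

/-- **Faithfulness of `r` is load-bearing for C′.** The C′ crux with `r : LatticeRep G` weakened to
a bare continuous unitary `ρ : G →* U(N)` (everything else verbatim, INCLUDING `Continuous a`) is
FALSE: witness `SU(2)` with `ρ = 1` (`Negative.UnfaithfulFalseSU`). -/
theorem unfaithfulC_false :
    ¬ (∀ (G : Type) [Group G] [TopologicalSpace G] [IsTopologicalGroup G] [CompactSpace G],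
        IsCompactSimpleLieGroup G →
          letI : MeasurableSpace G := borel G
          haveI : BorelSpace G := ⟨rfl⟩
          ∀ (N : ℕ) (ρ : G →* Matrix (Fin N) (Fin N) ℂ), Continuous ρ →
            (∀ g, ρ g ∈ Matrix.unitaryGroup (Fin N) ℂ) →
            ∃ (a : ℝ → ℝ), Continuous a ∧ ∃ (Γ : ℝ → ℝ) (β₀ ℓ₀ c C : ℝ), 0 < ℓ₀ ∧ 0 < c ∧
              (∀ β, 0 < a β) ∧ Filter.Tendsto a Filter.atTop (nhds 0) ∧
              (∀ s : ℝ, 0 < s → s ≤ ℓ₀ → 0 < Γ s ∧ Γ s ≤ 1) ∧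
              ∀ (L : ℕ) [NeZero L] (β : ℝ), β₀ ≤ β → (L : ℝ) * a β ≤ ℓ₀ →
                let P : (Fin 4 → ZMod L) → Fin 4 → Fin 4 → GaugeConfig 4 L G → ℝ :=
                  fun x i j U => (N : ℝ) - (ρ (plaquetteHolonomy U x i j)).trace.re
                let E : (GaugeConfig 4 L G → ℝ) → ℝ := fun F =>
                  wilsonExpectation (d := 4) (L := L) ρ β F
                let cov : (GaugeConfig 4 L G → ℝ) → (GaugeConfig 4 L G → ℝ) → ℝ := fun F F' =>
                  E (fun U => F U * F' U) - E F * E F'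
                let dist : (Fin 4 → ZMod L) → (Fin 4 → ZMod L) → ℝ := fun x y =>
                  Real.sqrt (∑ k : Fin 4, (((x k - y k).valMinAbs : ℤ) : ℝ) ^ 2)
                (∀ n : ℕ, 1 ≤ n → 8 * n ≤ L →
                    c * Γ ((n : ℝ) * a β) ≤
                        (n : ℝ) ^ 8 * cov (P 0 0 1) (P (Pi.single (2 : Fin 4) ((n : ℕ) : ZMod L)) 0 1) ∧
                      (n : ℝ) ^ 8 * cov (P 0 0 1) (P (Pi.single (2 : Fin 4) ((n : ℕ) : ZMod L)) 0 1) ≤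
                        C * Γ ((n : ℝ) * a β)) ∧
                  (∀ (x y : Fin 4 → ZMod L) (i j i' j' : Fin 4), x ≠ y → i ≠ j → i' ≠ j' →
                    |cov (P x i j) (P y i' j')| * dist x y ^ 8 ≤ C * Γ (dist x y * a β))) := by
  intro h
  refine UnfaithfulFalseSU.femtoCurvatureTwoPoint_unfaithful_false' ?_
  intro G _ _ _ _ hG N ρ hρ hρu
  obtain ⟨a, -, rest⟩ := h G hG N ρ hρ hρu
  exact ⟨a, rest⟩

/-- **`ConnectedSpace G` is load-bearing for C′.** The C′ crux with `IsCompactSimpleLieGroup G`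
weakened to `Nontrivial G` (everything else verbatim, INCLUDING `Continuous a`) is FALSE: witness
`ℤ₂` with its defining character (`Negative.FiniteGroupFalse`: shared-link pair `Ω(ε⁶)` against
axis pair `O(ε⁸)` at equal torus distance `1`). -/
theorem nontrivialC_false :
    ¬ (∀ (G : Type) [Group G] [TopologicalSpace G] [IsTopologicalGroup G] [CompactSpace G],
        Nontrivial G →
          letI : MeasurableSpace G := borel G
          haveI : BorelSpace G := ⟨rfl⟩
          ∀ (r : LatticeRep G), ∃ (a : ℝ → ℝ), Continuous a ∧ ∃ (Γ : ℝ → ℝ) (β₀ ℓ₀ c C : ℝ),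
            0 < ℓ₀ ∧ 0 < c ∧ (∀ β, 0 < a β) ∧ Filter.Tendsto a Filter.atTop (nhds 0) ∧
            (∀ s : ℝ, 0 < s → s ≤ ℓ₀ → 0 < Γ s ∧ Γ s ≤ 1) ∧
            ∀ (L : ℕ) [NeZero L] (β : ℝ), β₀ ≤ β → (L : ℝ) * a β ≤ ℓ₀ →
              let P : (Fin 4 → ZMod L) → Fin 4 → Fin 4 → GaugeConfig 4 L G → ℝ :=
                fun x i j U => (r.N : ℝ) - (r.ρ (plaquetteHolonomy U x i j)).trace.re
              let E : (GaugeConfig 4 L G → ℝ) → ℝ := fun F =>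
                wilsonExpectation (d := 4) (L := L) r.ρ β F
              let cov : (GaugeConfig 4 L G → ℝ) → (GaugeConfig 4 L G → ℝ) → ℝ := fun F F' =>
                E (fun U => F U * F' U) - E F * E F'
              let dist : (Fin 4 → ZMod L) → (Fin 4 → ZMod L) → ℝ := fun x y =>
                Real.sqrt (∑ k : Fin 4, (((x k - y k).valMinAbs : ℤ) : ℝ) ^ 2)
              (∀ n : ℕ, 1 ≤ n → 8 * n ≤ L →
                  c * Γ ((n : ℝ) * a β) ≤
                      (n : ℝ) ^ 8 * cov (P 0 0 1) (P (Pi.single (2 : Fin 4) ((n : ℕ) : ZMod L)) 0 1) ∧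
                    (n : ℝ) ^ 8 * cov (P 0 0 1) (P (Pi.single (2 : Fin 4) ((n : ℕ) : ZMod L)) 0 1) ≤
                      C * Γ ((n : ℝ) * a β)) ∧
                (∀ (x y : Fin 4 → ZMod L) (i j i' j' : Fin 4), x ≠ y → i ≠ j → i' ≠ j' →
                  |cov (P x i j) (P y i' j')| * dist x y ^ 8 ≤ C * Γ (dist x y * a β))) := by
  intro h
  refine FiniteGroupFalse.femtoCurvatureTwoPoint_nontrivial_false ?_
  intro G _ _ _ _ hG r
  obtain ⟨a, -, rest⟩ := h G hG r
  exact ⟨a, rest⟩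

variable {G : Type} [Group G] [TopologicalSpace G] [IsTopologicalGroup G] [CompactSpace G]
  [MeasurableSpace G] [BorelSpace G] {N : ℕ} {ρ : G →* Matrix (Fin N) (Fin N) ℂ}
  {a Γ : ℝ → ℝ} {β₀ ℓ₀ c C : ℝ}

/-- **No shape floor (C′ or not).** No package — continuous unit map or not — has `Γ` bounded
below by a positive constant on `(0, ℓ₀]`: the torus `L = 8` is eventually femto and its axis
covariance freezes (`Negative.ForcedDividend.no_shape_floor`). In particular the scale-free
strengthening `Γ ≡ γ` of C′ is FALSE for every compact `G` and continuous unitary `ρ`. -/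
theorem no_shape_floorC [SecondCountableTopology G] (hρ : Continuous ρ)
    (hρu : ∀ g, ρ g ∈ Matrix.unitaryGroup (Fin N) ℂ) (h : PackageWith ρ a Γ β₀ ℓ₀ c C)
    {γ₀ : ℝ} (hγ : 0 < γ₀) (hfloor : ∀ s : ℝ, 0 < s → s ≤ ℓ₀ → γ₀ ≤ Γ s) : False := by
  obtain ⟨hℓ, hc, ha, hat, hΓ, hcl⟩ := h
  exact ForcedDividend.no_shape_floor ρ hρ hρu hℓ hc ha hat (fun s hs hs' => (hΓ s hs hs').1)
    (fun L _ β hβ hL n hn hnL => ((hcl L β hβ hL).1 n hn hnL).1) hγ hfloor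

end Inherited

/-! ## § Running — what `Continuous a` makes load-bearing: RG chains, forced dimensional
transmutation, and incompatibility with any UNIFORM freezing of the diagonal femto amplitudes -/

section Running

/-- **Levels of a continuous unit map are attained beyond any base point.** If `a` is continuous
and tends to `0`, every level `t ∈ (0, a(B)]` is attained at some `β ≥ B`. -/
theorem exists_ge_level {a : ℝ → ℝ} (hcont : Continuous a) (hat : Tendsto a atTop (𝓝 0))
    {B t : ℝ} (ht0 : 0 < t) (ht : t ≤ a B) : ∃ β : ℝ, B ≤ β ∧ a β = t := by
  obtain ⟨B', hB't, hBB'⟩ := ((hat.eventually (Iio_mem_nhds ht0)).and (eventually_ge_atTop B)).exists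
  obtain ⟨x, hx, hxt⟩ :=
    intermediate_value_Icc' hBB' hcont.continuousOn ⟨le_of_lt hB't, ht⟩
  exact ⟨x, hx.1, hxt⟩

/-- **Level couplings diverge.** If `a` is continuous and positive and `β_n ≥ B` solve
`n · a(β_n) = s` for all `n ≥ 1`, then `β_n → ∞`: on every compact `[B, M]` the unit map has a
positive minimum, below which `s/n` eventually falls. -/
theorem tendsto_atTop_of_levels {a : ℝ → ℝ} (hcont : Continuous a) (ha : ∀ β, 0 < a β)
    {B s : ℝ} {βs : ℕ → ℝ} (hB : ∀ n : ℕ, 1 ≤ n → B ≤ βs n)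
    (hlev : ∀ n : ℕ, 1 ≤ n → (n : ℝ) * a (βs n) = s) : Tendsto βs atTop atTop := by
  refine tendsto_atTop.2 fun M => ?_
  obtain ⟨x, hx, hmin⟩ :=
    isCompact_Icc.exists_isMinOn (nonempty_Icc.2 (le_max_left B M)) hcont.continuousOn
  have hm0 : 0 < a x := ha x
  obtain ⟨n₀, hn₀⟩ := exists_nat_gt (s / a x)
  refine eventually_atTop.2 ⟨n₀ + 1, fun n hn => ?_⟩
  have hn1 : 1 ≤ n := le_trans (Nat.le_add_left 1 n₀) hn
  have hnpos : (0 : ℝ) < n := by exact_mod_cast hn1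
  -- `a (βs n) = s / n < a x`, so `βs n ∉ [B, max B M]`, hence `βs n > M`
  have hsmall : a (βs n) < a x := by
    have h1 : a (βs n) = s / n := by
      rw [eq_div_iff hnpos.ne', mul_comm]; exact hlev n hn1
    have h2 : s / a x < n := lt_of_lt_of_le hn₀ (by exact_mod_cast (Nat.le_succ n₀).trans hn)
    rw [h1, div_lt_iff₀ hnpos]
    rw [div_lt_iff₀ hm0] at h2
    linarith
  by_contra hM
  have hmem : βs n ∈ Icc B (max B M) := ⟨hB n hn1, (not_le.1 hM).le.trans (le_max_right B M)⟩
  exact absurd (hmin hmem) (not_le.2 hsmall)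

variable {G : Type} [Group G] [TopologicalSpace G] [IsTopologicalGroup G] [CompactSpace G]
  [MeasurableSpace G] [BorelSpace G] {N : ℕ} {ρ : G →* Matrix (Fin N) (Fin N) ℂ}
  {a Γ : ℝ → ℝ} {β₀ ℓ₀ c C : ℝ}

/-- **RG chains exist (the mechanism `Continuous a` switches on).** For a package with a continuous
unit map, every level `s ∈ (0, a(β₀)]` with `8 s ≤ ℓ₀` and every `n ≥ 1` admit a coupling
`β ≥ β₀` with `n · a(β) = s`; there the torus `8n` is femto and the axis clause pins
`n⁸ Cov_{8n,β}(n)` two-sidedly to the SINGLE number `Γ(s)` — the same for every `n`. -/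
theorem PackageWith.exists_chain (h : PackageWith ρ a Γ β₀ ℓ₀ c C) (hcont : Continuous a)
    {s : ℝ} (hs0 : 0 < s) (hs : s ≤ a β₀) (hsℓ : 8 * s ≤ ℓ₀) {n : ℕ} [NeZero (8 * n)]
    (hn : 1 ≤ n) :
    ∃ β : ℝ, β₀ ≤ β ∧ (n : ℝ) * a β = s ∧ ((8 * n : ℕ) : ℝ) * a β ≤ ℓ₀ ∧
      c * Γ s ≤ (n : ℝ) ^ 8 * axisCov ρ (8 * n) β n ∧
        (n : ℝ) ^ 8 * axisCov ρ (8 * n) β n ≤ C * Γ s := by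
  obtain ⟨-, -, ha, hat, -, hcl⟩ := h
  have hnpos : (0 : ℝ) < n := by exact_mod_cast hn
  have hlev : s / n ≤ a β₀ := (div_le_self hs0.le (by exact_mod_cast hn)).trans hs
  obtain ⟨β, hβ, hβs⟩ := exists_ge_level hcont hat (div_pos hs0 hnpos) hlev
  have harg : (n : ℝ) * a β = s := by rw [hβs]; field_simp
  have hfem : ((8 * n : ℕ) : ℝ) * a β ≤ ℓ₀ := by push_cast; nlinarith
  have hax := (hcl (8 * n) β hβ hfem).1 n hn le_rfl
  rw [harg] at hax
  exact ⟨β, hβ, harg, hfem, hax.1, hax.2⟩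

/-- **Dimensional transmutation is FORCED by C′.** Any package with a continuous unit map comes
with RG chains: for every small level `s` a sequence of couplings `β_n(s) → ∞` (`n → ∞`) along
which the tori `8n` are femto and `c Γ(s) ≤ n⁸ Cov_{8n,β_n(s)}(n) ≤ C Γ(s)` with `Γ(s) > 0` FIXED:
the coupling at which the torus `8n` de-freezes to the level `Γ(s)` diverges with `n`. (For
`a = a_AF` this is `β_n(s) = b log n + β(s)`, asymptotic-freedom step scaling.) -/
theorem PackageWith.chain_tendsto (h : PackageWith ρ a Γ β₀ ℓ₀ c C) (hcont : Continuous a)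
    {s : ℝ} {βs : ℕ → ℝ} (hB : ∀ n : ℕ, 1 ≤ n → β₀ ≤ βs n)
    (hlev : ∀ n : ℕ, 1 ≤ n → (n : ℝ) * a (βs n) = s) : Tendsto βs atTop atTop :=
  tendsto_atTop_of_levels hcont h.2.2.1 hB hlev

/-- **Uniform diagonal freezing** of the femto amplitudes of `ρ`: ONE rate `φ(β) → 0` bounds
`n⁸ Cov_{8n,β}(P_0^{01}, P_{ne₂}^{01})` for ALL `n ≥ 1` at once (`β ≥ β₁`). Every Gaussian /
abelian lattice gauge theory has it with `φ(β) = K β⁻²` (bare-coupling law, no running); for an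
asymptotically free theory it FAILS (`n⁸ Cov_{8n,β}(n) ≍ κ/(β − b log n)²` is not uniformly small). -/
def UniformDiagonalFreezing (ρ : G →* Matrix (Fin N) (Fin N) ℂ) : Prop :=
  ∃ φ : ℝ → ℝ, Tendsto φ atTop (𝓝 0) ∧ ∃ β₁ : ℝ, ∀ (n : ℕ) [NeZero (8 * n)] (β : ℝ),
    1 ≤ n → β₁ ≤ β → (n : ℝ) ^ 8 * axisCov ρ (8 * n) β n ≤ φ β

/-- **KILL SWITCH (running is load-bearing).** A package with a CONTINUOUS unit map is
incompatible with uniform diagonal freezing — for every compact `G`, every `ρ`, every shape `Γ`: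
along the RG chain at a fixed small level `s` the lower bound keeps `n⁸ Cov_{8n,β_n}(n) ≥ c Γ(s) > 0`
while `β_n → ∞`, so no `n`-uniform rate `φ(β_n) → 0` can dominate it. Only the LOWER bound, the
positivity/continuity/decay of `a` and `Γ > 0` are used. -/
theorem PackageWith.not_uniformDiagonalFreezing (h : PackageWith ρ a Γ β₀ ℓ₀ c C)
    (hcont : Continuous a) : ¬ UniformDiagonalFreezing ρ := by
  rintro ⟨φ, hφ, β₁, hU⟩
  have hℓ := h.1
  have hc := h.2.1
  have ha := h.2.2.1
  have hat := h.2.2.2.1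
  have hΓ := h.2.2.2.2.1
  -- base point and level
  set B : ℝ := max β₀ β₁ with hB_def
  set s : ℝ := min (a B / 2) (ℓ₀ / 8) with hs_def
  have hs0 : 0 < s := lt_min (half_pos (ha B)) (by linarith)
  have hsB : s ≤ a B := (min_le_left _ _).trans (half_le_self (ha B).le)
  have hsℓ : 8 * s ≤ ℓ₀ := by
    have := min_le_right (a B / 2) (ℓ₀ / 8); linarith
  have hΓs : 0 < Γ s := (hΓ s hs0 (by linarith)).1
  have hε : 0 < c * Γ s := mul_pos hc hΓs
  -- beyond `B'` the uniform rate is below the chain level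
  obtain ⟨B', hB'⟩ := eventually_atTop.1 (hφ.eventually (Iio_mem_nhds hε))
  -- positive minimum of `a` on `[B, max B B']`
  obtain ⟨x, hx, hmin⟩ :=
    isCompact_Icc.exists_isMinOn (nonempty_Icc.2 (le_max_left B B')) hcont.continuousOn
  have hm0 : 0 < a x := ha x
  -- an `n` with `s / n < a x`
  obtain ⟨n₀, hn₀⟩ := exists_nat_gt (s / a x)
  set n : ℕ := n₀ + 1 with hn_def
  have hn1 : 1 ≤ n := Nat.le_add_left 1 n₀
  have hnpos : (0 : ℝ) < n := by exact_mod_cast hn1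
  haveI : NeZero (8 * n) := ⟨by omega⟩
  -- the package restricted to base point `B`
  have hB0 : β₀ ≤ B := le_max_left _ _
  have h' : PackageWith ρ a Γ B ℓ₀ c C :=
    ⟨hℓ, hc, ha, hat, hΓ, fun L _ β hβ hL => h.2.2.2.2.2 L β (hB0.trans hβ) hL⟩
  obtain ⟨β, hBβ, harg, -, hlow, -⟩ := h'.exists_chain hcont hs0 hsB hsℓ hn1
  -- uniform freezing at `β ≥ β₁`
  have hup := hU n β hn1 ((le_max_right β₀ β₁).trans hBβ)
  have hφβ : c * Γ s ≤ φ β := hlow.trans hup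
  -- hence `β < B'`, so `β ∈ [B, max B B']` and `a β ≥ a x`
  have hβB' : β ≤ max B B' := by
    refine le_trans ?_ (le_max_right B B')
    by_contra hlt
    exact absurd (hB' β (not_le.1 hlt).le) (not_lt.2 hφβ)
  have hax : a x ≤ a β := hmin ⟨hBβ, hβB'⟩
  -- but `a β = s / n < a x`
  have h1 : a β * n = s := by rw [mul_comm]; exact harg
  have h2 : s < n * a x := by
    have : s / a x < n := lt_of_lt_of_le hn₀ (by exact_mod_cast Nat.le_succ n₀)
    rwa [div_lt_iff₀ hm0] at this
  nlinarith

/-- **C′ at `ρ` is refuted by uniform diagonal freezing** (template: ONE faithful `r` of ONE compact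
simple Lie group whose diagonal femto amplitudes freeze at an `n`-uniform rate kills the crux). -/
theorem not_packageCRho_of_uniformDiagonalFreezing (hU : UniformDiagonalFreezing ρ) :
    ¬ PackageCRho ρ := by
  rintro ⟨a, hcont, Γ, β₀, ℓ₀, c, C, h⟩
  exact h.not_uniformDiagonalFreezing hcont hU

/-- Positive reformulation: **C′ forces UNBOUNDED de-freezing** — for every candidate rate
`φ → 0` and every threshold there are `n ≥ 1` and `β` beyond the threshold with
`n⁸ Cov_{8n,β}(n) > φ(β)`. With `φ = K β⁻²` (any `K`): the amplitude in units of the bare coupling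
squared is unbounded over femto data — the running coupling must outgrow the bare one. -/
theorem PackageWith.exists_exceeds (h : PackageWith ρ a Γ β₀ ℓ₀ c C) (hcont : Continuous a)
    {φ : ℝ → ℝ} (hφ : Tendsto φ atTop (𝓝 0)) (β₁ : ℝ) :
    ∃ (n : ℕ) (_ : NeZero (8 * n)) (β : ℝ), 1 ≤ n ∧ β₁ ≤ β ∧
      φ β < (n : ℝ) ^ 8 * axisCov ρ (8 * n) β n := by
  by_contra hcon
  refine h.not_uniformDiagonalFreezing hcont ⟨φ, hφ, β₁, fun n _ β hn hβ => ?_⟩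
  exact not_lt.1 fun hlt => hcon ⟨n, ‹_›, β, hn, hβ, hlt⟩

/-- **The Gaussian / bare-coupling law kills C′.** If the diagonal femto amplitudes of `ρ` obey
`n⁸ Cov_{8n,β}(n) ≤ K β⁻²` for all `n ≥ 1`, `β ≥ β₁` (the law of every free / abelian lattice
gauge field: covariance = (bare coupling)² × kernel², NO running), then no continuous unit map
carries a package. For the typed predecessor this hypothesis is harmless (compact `U(1)` passes it,
gen-2 verdict); for C′ it is fatal — the kernel-checked form of "C′ makes asymptotic freedom
load-bearing". -/
theorem not_packageCRho_of_bareLaw {K β₁ : ℝ}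
    (hK : ∀ (n : ℕ) [NeZero (8 * n)] (β : ℝ), 1 ≤ n → β₁ ≤ β →
      (n : ℝ) ^ 8 * axisCov ρ (8 * n) β n ≤ K / β ^ 2) :
    ¬ PackageCRho ρ := by
  refine not_packageCRho_of_uniformDiagonalFreezing ⟨fun β => K / β ^ 2, ?_, β₁, hK⟩
  exact tendsto_const_nhds.div_atTop (tendsto_pow_atTop two_ne_zero)

end Running

section RunningCrux

variable {G : Type} [Group G] [TopologicalSpace G] [IsTopologicalGroup G] [CompactSpace G]

/-- **Refutation template for the crux.** If for ONE compact simple Lie `G` and ONE faithful `r` the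
diagonal femto amplitudes freeze uniformly, `FemtoCurvatureTwoPointC` is false. (For the typed
predecessor this template is EMPTY — compact-`U(1)`-like uniform `β⁻²` freezing is compatible with
the typed body through a generic step unit map; for C′ it is the honest dividing line: asymptotic
freedom versus a Gaussian fixed point.) -/
theorem femtoCurvatureTwoPointC_false_of_uniformFreezing (hG : IsCompactSimpleLieGroup G)
    (r : LatticeRep G)
    (hU : letI : MeasurableSpace G := borel G
      haveI : BorelSpace G := ⟨rfl⟩
      UniformDiagonalFreezing r.ρ) :
    ¬ FemtoCurvatureTwoPointC := fun hC =>
  letI : MeasurableSpace G := borel G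
  haveI : BorelSpace G := ⟨rfl⟩
  not_packageCRho_of_uniformDiagonalFreezing hU (hC G hG r)

/-- The same with the group hypothesis discharged: `SU(n)`, `n ≥ 2`
(`Negative.UnfaithfulFalseSU.isCompactSimpleLieGroup_su`). -/
theorem femtoCurvatureTwoPointC_false_of_uniformFreezing_su {n : ℕ} (hn : 2 ≤ n)
    (r : LatticeRep (Matrix.specialUnitaryGroup (Fin n) ℂ))
    (hU : letI : MeasurableSpace (Matrix.specialUnitaryGroup (Fin n) ℂ) := borel _
      haveI : BorelSpace (Matrix.specialUnitaryGroup (Fin n) ℂ) := ⟨rfl⟩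
      UniformDiagonalFreezing r.ρ) :
    ¬ FemtoCurvatureTwoPointC :=
  femtoCurvatureTwoPointC_false_of_uniformFreezing (UnfaithfulFalseSU.isCompactSimpleLieGroup_su hn)
    r hU

end RunningCrux

/-! ## § UpperOnlyC — tightness: without the lower bound continuity costs nothing; the
`∀ a`-strengthening is false (parasitic CONTINUOUS unit maps exist) -/

section Majorant

/-- **Continuous majorant tending to zero** (analysis). Every `σ : ℝ → ℝ` with `0 < σ ≤ 1` and
`σ → 0` at `+∞` lies below a CONTINUOUS positive `g` with `g → 0`: `g(β) = ∫_β^{β+1} E` for the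
running supremum `E(t) = sup_{u ≥ t-1} σ(u)` (antitone, hence locally integrable; `E(β+1) ≤ g(β) ≤
E(β)`). This is what turns every step-function construction of the typed item (thresholds from
freezing) into a witness / counter-witness with a continuous unit map. -/
theorem exists_continuous_majorant {σ : ℝ → ℝ} (hσ0 : ∀ β, 0 < σ β) (hσ1 : ∀ β, σ β ≤ 1)
    (hσ : Tendsto σ atTop (𝓝 0)) :
    ∃ g : ℝ → ℝ, Continuous g ∧ (∀ β, σ β ≤ g β) ∧ (∀ β, 0 < g β) ∧ Tendsto g atTop (𝓝 0) := by
  -- running supremum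
  set E : ℝ → ℝ := fun t => sSup (σ '' Ici (t - 1)) with hE_def
  have hbdd : ∀ t, BddAbove (σ '' Ici (t - 1)) := fun t =>
    ⟨1, by rintro _ ⟨u, -, rfl⟩; exact hσ1 u⟩
  have hne : ∀ t, (σ '' Ici (t - 1)).Nonempty := fun t => ⟨σ t, t, by simp, rfl⟩
  have hEσ : ∀ {t u : ℝ}, t - 1 ≤ u → σ u ≤ E t := fun {t u} h => le_csSup (hbdd t) ⟨u, h, rfl⟩
  have hE0 : ∀ t, 0 < E t := fun t => (hσ0 t).trans_le (hEσ (by linarith))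
  have hEanti : Antitone E := fun t t' htt' =>
    csSup_le_csSup (hbdd t) (hne t') (image_mono (Ici_subset_Ici.2 (by linarith)))
  have hEint : ∀ x y : ℝ, IntervalIntegrable E volume x y := fun x y =>
    (hEanti.antitoneOn _).intervalIntegrable
  have hEt : Tendsto E atTop (𝓝 0) := by
    refine Metric.tendsto_atTop.2 fun ε hε => ?_
    obtain ⟨B, hB⟩ := eventually_atTop.1 (hσ.eventually (Iio_mem_nhds (half_pos hε)))
    refine ⟨B + 1, fun t ht => ?_⟩
    rw [Real.dist_eq, sub_zero, abs_of_pos (hE0 t)]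
    refine lt_of_le_of_lt (csSup_le (hne t) ?_) (half_lt_self hε)
    rintro _ ⟨u, hu, rfl⟩
    exact le_of_lt (hB u (by simp only [mem_Ici] at hu; linarith))
  -- the majorant `g β = F (β + 1) - F β`, `F` the primitive of `E`
  set F : ℝ → ℝ := fun x => ∫ t in (0 : ℝ)..x, E t with hF_def
  have hF : Continuous F := intervalIntegral.continuous_primitive hEint 0
  have hg_eq : ∀ β : ℝ, F (β + 1) - F β = ∫ t in β..β + 1, E t := fun β =>
    intervalIntegral.integral_interval_sub_left (hEint 0 (β + 1)) (hEint 0 β)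
  have hg_lower : ∀ β : ℝ, E (β + 1) ≤ F (β + 1) - F β := fun β => by
    rw [hg_eq]
    have h : (∫ _ in β..β + 1, E (β + 1)) ≤ ∫ u in β..β + 1, E u :=
      intervalIntegral.integral_mono_on (by linarith) intervalIntegrable_const (hEint β (β + 1))
        (fun t ht => hEanti ht.2)
    rwa [intervalIntegral.integral_const, show β + 1 - β = (1 : ℝ) by ring, one_smul] at h
  have hg_upper : ∀ β : ℝ, F (β + 1) - F β ≤ E β := fun β => by
    rw [hg_eq]
    have h : (∫ u in β..β + 1, E u) ≤ ∫ _ in β..β + 1, E β :=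
      intervalIntegral.integral_mono_on (by linarith) (hEint β (β + 1)) intervalIntegrable_const
        (fun t ht => hEanti ht.1)
    rwa [intervalIntegral.integral_const, show β + 1 - β = (1 : ℝ) by ring, one_smul] at h
  refine ⟨fun β => F (β + 1) - F β, (hF.comp (continuous_id.add continuous_const)).sub hF,
    fun β => (hEσ (by linarith)).trans (hg_lower β), fun β => (hE0 _).trans_le (hg_lower β), ?_⟩
  exact tendsto_of_tendsto_of_tendsto_of_le_of_le tendsto_const_nhds hEt
    (fun β => ((hE0 _).trans_le (hg_lower β)).le) hg_upper

end Majorant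

section UpperOnlyC

variable {G : Type} [Group G] [TopologicalSpace G] [IsTopologicalGroup G] [CompactSpace G]
  [MeasurableSpace G] [BorelSpace G] {N : ℕ} {ρ : G →* Matrix (Fin N) (Fin N) ℂ}
  {a Γ : ℝ → ℝ} {β₀ ℓ₀ c C : ℝ}

variable (ρ) in
/-- The crux clauses on one torus with the LOWER bound deleted. -/
def UpperClauses (a Γ : ℝ → ℝ) (C : ℝ) (L : ℕ) [NeZero L] (β : ℝ) : Prop :=
  (∀ n : ℕ, 1 ≤ n → 8 * n ≤ L → (n : ℝ) ^ 8 * axisCov ρ L β n ≤ C * Γ ((n : ℝ) * a β)) ∧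
    ∀ (x y : Site 4 L) (i j i' j' : Fin 4), x ≠ y → i ≠ j → i' ≠ j' →
      |cov ρ β (plaq ρ x i j) (plaq ρ y i' j')| * tdist x y ^ 8 ≤ C * Γ (tdist x y * a β)

variable (ρ) in
/-- **C′ minus its lower bound**: a CONTINUOUS unit map `a > 0`, `a → 0`, a shape `0 < Γ ≤ 1` on
`(0, ℓ₀]` and the UPPER clauses on every femto torus. -/
def UpperOnlyCWith (a Γ : ℝ → ℝ) (β₀ ℓ₀ C : ℝ) : Prop :=
  Continuous a ∧ 0 < ℓ₀ ∧ (∀ β, 0 < a β) ∧ Tendsto a atTop (𝓝 0) ∧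
    (∀ s : ℝ, 0 < s → s ≤ ℓ₀ → 0 < Γ s ∧ Γ s ≤ 1) ∧
      ∀ (L : ℕ) [NeZero L] (β : ℝ), β₀ ≤ β → (L : ℝ) * a β ≤ ℓ₀ → UpperClauses ρ a Γ C L β

/-- `UpperOnlyCWith` IS the C′ package with the lower bound deleted (so `exists_upperOnlyCWith`
below says exactly: that lower bound is the unique load-bearing clause of C′). -/
theorem PackageWith.upperOnlyCWith (h : PackageWith ρ a Γ β₀ ℓ₀ c C) (hcont : Continuous a) :
    UpperOnlyCWith ρ a Γ β₀ ℓ₀ C := by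
  obtain ⟨hℓ, -, ha, hat, hΓ, hcl⟩ := h
  exact ⟨hcont, hℓ, ha, hat, hΓ, fun L _ β hβ hL =>
    ⟨fun n hn hnL => ((hcl L β hβ hL).1 n hn hnL).2, (hcl L β hβ hL).2⟩⟩

/-- **The upper-only variant of C′ HOLDS** for every compact second-countable `G` and continuous
unitary `ρ` (`Γ ≡ 1`, `C = 1`, `ℓ₀ = 1`): a continuous majorant (`exists_continuous_majorant`) of
the typed item's slow step unit map (`Negative.UpperOnly.exists_upperOnly`, freezing thresholds)
is again a unit map, and shrinking the femto family only helps the upper bounds. So `Continuous a`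
adds NO content on the upper side: the lower bound along RG chains (§ Running) is all of C′. -/
theorem exists_upperOnlyCWith [SecondCountableTopology G] (hρ : Continuous ρ)
    (hρu : ∀ g, ρ g ∈ Matrix.unitaryGroup (Fin N) ℂ) :
    ∃ (a : ℝ → ℝ) (β₀ : ℝ), UpperOnlyCWith ρ a (fun _ => 1) β₀ 1 1 := by
  obtain ⟨a, β₀, ha, hat, hcl⟩ := UpperOnly.exists_upperOnly ρ hρ hρu
  -- truncate at `1` and majorise continuously
  have hσ0 : ∀ β, 0 < min (a β) 1 := fun β => lt_min (ha β) one_pos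
  have hσ1 : ∀ β, min (a β) 1 ≤ 1 := fun β => min_le_right _ _
  have hσt : Tendsto (fun β => min (a β) 1) atTop (𝓝 0) := by
    simpa using hat.min (tendsto_const_nhds (x := (1 : ℝ)))
  obtain ⟨g, hg, hσg, hg0, hgt⟩ := exists_continuous_majorant hσ0 hσ1 hσt
  obtain ⟨B, hB⟩ := eventually_atTop.1 (hat.eventually (Iic_mem_nhds one_pos))
  refine ⟨g, max β₀ B, hg, one_pos, hg0, hgt, fun s _ _ => ⟨one_pos, le_rfl⟩, ?_⟩
  intro L _ β hβ hL
  have haβ : a β ≤ 1 := hB β ((le_max_right _ _).trans hβ)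
  have hag : a β ≤ g β := by have := hσg β; rwa [min_eq_left haβ] at this
  have hL' : (L : ℝ) * a β ≤ 1 := (mul_le_mul_of_nonneg_left hag (Nat.cast_nonneg L)).trans hL
  have h := hcl L β ((le_max_left _ _).trans hβ) hL'
  refine ⟨fun n hn hnL => ?_, fun x y i j i' j' _ _ _ => ?_⟩
  · rw [one_mul]; exact h.1 n hn hnL
  · rw [one_mul]; exact h.2 x y i j i' j'

omit [MeasurableSpace G] [BorelSpace G] in
/-- The faithful-representation form (the crux's Borel σ-algebra; second countability from `r`). -/
theorem exists_upperOnlyCWith_rep (r : LatticeRep G) :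
    letI : MeasurableSpace G := borel G
    haveI : BorelSpace G := ⟨rfl⟩
    ∃ (a : ℝ → ℝ) (β₀ : ℝ), UpperOnlyCWith r.ρ a (fun _ => 1) β₀ 1 1 := by
  letI : MeasurableSpace G := borel G
  haveI : BorelSpace G := ⟨rfl⟩
  haveI : SecondCountableTopology G := secondCountable_of_latticeRep r
  exact exists_upperOnlyCWith r.continuous r.mem_unitary

/-- **The `∀ a`-strengthening of C′ is FALSE** for every compact second-countable `G` and continuous
unitary `ρ`: it is NOT true that every continuous unit map `a > 0`, `a → 0` carries some package
`(Γ, β₀, ℓ₀, c, C)`. Counter-map: a continuous majorant of the step function `1/(M(β)+1)`, `M(β)`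
the number of diagonal freezing thresholds `T'(m)` passed at `β` (`(m+1)⁸ Cov_{8(m+1),β}(m+1) ≤
1/(m+1)` beyond `T(m)`); along its RG chain at any level `s ≤ 1/2` the torus `8(m+1)` is met only
beyond `T(m)`, so the lower bound gives `c Γ(s) ≤ 1/(m+1)` for every `m`. Continuity alone does
not pin the unit map; two-sidedness along the chains does (§ Running). -/
theorem forallA_false [SecondCountableTopology G] (hρ : Continuous ρ)
    (hρu : ∀ g, ρ g ∈ Matrix.unitaryGroup (Fin N) ℂ) :
    ¬ ∀ a : ℝ → ℝ, Continuous a → (∀ β, 0 < a β) → Tendsto a atTop (𝓝 0) →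
        ∃ (Γ : ℝ → ℝ) (β₀ ℓ₀ c C : ℝ), PackageWith ρ a Γ β₀ ℓ₀ c C := by
  intro hall
  classical
  -- diagonal freezing thresholds: beyond `T m`, `(m+1)⁸ Cov_{8(m+1),β}(m+1) ≤ 1/(m+1)`
  have hE : ∀ m : ℕ, ∀ᶠ β in atTop,
      ((m + 1 : ℕ) : ℝ) ^ 8 * axisCov ρ (8 * (m + 1)) β (m + 1) ≤ 1 / ((m : ℝ) + 1) := fun m => by
    haveI : NeZero (8 * (m + 1)) := ⟨by omega⟩
    have ht := (PlaquetteFreezing.tendsto_plaquetteCov ρ hρ hρu (0 : Site 4 (8 * (m + 1)))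
      (Pi.single (2 : Fin 4) (((m + 1 : ℕ) : ℕ) : ZMod (8 * (m + 1)))) 0 1 0 1).const_mul
      (((m + 1 : ℕ) : ℝ) ^ 8)
    rw [mul_zero] at ht
    filter_upwards [ht.eventually (Iic_mem_nhds (by positivity : (0 : ℝ) < 1 / ((m : ℝ) + 1)))]
      with β hβ
    exact hβ
  choose T hT using fun m => eventually_atTop.1 (hE m)
  -- monotone envelope `T' m ≥ max (T m) m`
  set T' : ℕ → ℝ := fun m => (∑ k ∈ Finset.range (m + 1), |T k|) + m with hT'_def
  have hT'T : ∀ m, T m ≤ T' m := fun m => by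
    have h1 : |T m| ≤ ∑ k ∈ Finset.range (m + 1), |T k| :=
      Finset.single_le_sum (fun k _ => abs_nonneg (T k)) (Finset.self_mem_range_succ m)
    have h2 := le_abs_self (T m)
    have h3 : (0 : ℝ) ≤ m := Nat.cast_nonneg m
    simp only [hT'_def]
    linarith
  have hT'm : ∀ m : ℕ, (m : ℝ) ≤ T' m := fun m => by
    have := Finset.sum_nonneg fun k (_ : k ∈ Finset.range (m + 1)) => abs_nonneg (T k)
    simp only [hT'_def]
    linarith
  have hT'mono : ∀ {m m' : ℕ}, m ≤ m' → T' m ≤ T' m' := fun {m m'} hmm' => by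
    simp only [hT'_def]
    have h1 : ∑ k ∈ Finset.range (m + 1), |T k| ≤ ∑ k ∈ Finset.range (m' + 1), |T k| :=
      Finset.sum_le_sum_of_subset_of_nonneg (Finset.range_mono (by omega))
        fun k _ _ => abs_nonneg (T k)
    have h2 : (m : ℝ) ≤ m' := by exact_mod_cast hmm'
    linarith
  -- counting function and the step minorant `σ = 1/(M+1)`
  set M : ℝ → ℕ := fun β => Nat.findGreatest (fun m => T' m ≤ β) ⌊β⌋₊ with hM_def
  have hMge : ∀ (β : ℝ) (m : ℕ), T' m ≤ β → m ≤ M β := fun β m hm =>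
    Nat.le_findGreatest (Nat.le_floor ((hT'm m).trans hm)) hm
  have hMspec : ∀ β : ℝ, M β ≠ 0 → T' (M β) ≤ β := fun β h =>
    Nat.findGreatest_of_ne_zero rfl h
  set σ : ℝ → ℝ := fun β => 1 / ((M β : ℝ) + 1) with hσ_def
  have hσ0 : ∀ β, 0 < σ β := fun β => by simp only [hσ_def]; positivity
  have hσ1 : ∀ β, σ β ≤ 1 := fun β => by
    simp only [hσ_def]
    rw [div_le_one (by positivity)]
    linarith [Nat.cast_nonneg (α := ℝ) (M β)]
  have hσt : Tendsto σ atTop (𝓝 0) := by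
    refine Metric.tendsto_atTop.2 fun ε hε => ?_
    obtain ⟨k, hk⟩ := exists_nat_one_div_lt hε
    refine ⟨T' k, fun β hβ => ?_⟩
    rw [Real.dist_eq, sub_zero, abs_of_pos (hσ0 β)]
    have hkM : (k : ℝ) + 1 ≤ (M β : ℝ) + 1 := by exact_mod_cast Nat.succ_le_succ (hMge β k hβ)
    calc σ β = 1 / ((M β : ℝ) + 1) := rfl
      _ ≤ 1 / ((k : ℝ) + 1) := one_div_le_one_div_of_le (by positivity) hkM
      _ < ε := hk
  -- KEY: the level `1/(m+2)` of `σ` is reached only beyond the threshold `T m`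
  have hP : ∀ (m : ℕ) (β : ℝ), σ β ≤ 1 / ((m : ℝ) + 2) → T m ≤ β := fun m β hle => by
    have h1 : (m : ℝ) + 2 ≤ (M β : ℝ) + 1 :=
      (one_div_le_one_div (by positivity) (by positivity)).1 hle
    have h2 : m + 1 ≤ M β := by exact_mod_cast (by linarith : (m : ℝ) + 1 ≤ M β)
    exact (hT'T m).trans ((hT'mono (by omega : m ≤ M β)).trans (hMspec β (by omega)))
  -- the parasitic CONTINUOUS unit map and its alleged package
  obtain ⟨g, hg, hσg, hg0, hgt⟩ := exists_continuous_majorant hσ0 hσ1 hσt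
  obtain ⟨Γ, β₀, ℓ₀, c, C, h⟩ := hall g hg hg0 hgt
  have hℓ := h.1
  have hc := h.2.1
  have hΓ := h.2.2.2.2.1
  -- a chain level `s ≤ min (g β₀) (ℓ₀/8) (1/2)`
  set s : ℝ := min (g β₀) (min (ℓ₀ / 8) (1 / 2)) with hs_def
  have hs0 : 0 < s := lt_min (hg0 β₀) (lt_min (by linarith) (by norm_num))
  have hsg : s ≤ g β₀ := min_le_left _ _
  have hsℓ : 8 * s ≤ ℓ₀ := by
    have := (min_le_right (g β₀) _).trans (min_le_left (ℓ₀ / 8) (1 / 2)); linarith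
  have hs2 : s ≤ 1 / 2 := (min_le_right (g β₀) _).trans (min_le_right _ _)
  have hΓs : 0 < Γ s := (hΓ s hs0 (by linarith)).1
  -- along the chain the lower bound sits below `1/(m+1)` for EVERY `m`
  have hchain : ∀ m : ℕ, c * Γ s ≤ 1 / ((m : ℝ) + 1) := fun m => by
    haveI : NeZero (8 * (m + 1)) := ⟨by omega⟩
    obtain ⟨β, -, harg, -, hlow, -⟩ := h.exists_chain hg hs0 hsg hsℓ (n := m + 1) (Nat.succ_pos m)
    have hmpos : (0 : ℝ) < (m : ℝ) + 1 := by positivity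
    have hgβ : g β = s / ((m : ℝ) + 1) := by
      rw [eq_div_iff hmpos.ne']
      push_cast at harg
      linear_combination harg
    have hkey : ((m : ℝ) + 2) * s ≤ (m : ℝ) + 1 := by
      have := mul_le_mul_of_nonneg_left hs2 (by positivity : (0 : ℝ) ≤ (m : ℝ) + 2)
      have hm0 : (0 : ℝ) ≤ m := Nat.cast_nonneg m
      linarith
    have hσle : σ β ≤ 1 / ((m : ℝ) + 2) := by
      refine (hσg β).trans ?_
      rw [hgβ, div_le_iff₀ hmpos, one_div, le_inv_mul_iff₀ (by positivity : (0 : ℝ) < (m : ℝ) + 2)]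
      exact hkey
    exact hlow.trans (hT m β (hP m β hσle))
  obtain ⟨m, hm⟩ := exists_nat_one_div_lt (mul_pos hc hΓs)
  exact absurd (hchain m) (not_le.2 hm)

omit [MeasurableSpace G] [BorelSpace G] in
/-- The faithful-representation form of `forallA_false` (the crux's Borel σ-algebra). -/
theorem forallA_false_rep (r : LatticeRep G) :
    letI : MeasurableSpace G := borel G
    haveI : BorelSpace G := ⟨rfl⟩
    ¬ ∀ a : ℝ → ℝ, Continuous a → (∀ β, 0 < a β) → Tendsto a atTop (𝓝 0) →
        ∃ (Γ : ℝ → ℝ) (β₀ ℓ₀ c C : ℝ), PackageWith r.ρ a Γ β₀ ℓ₀ c C := by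
  letI : MeasurableSpace G := borel G
  haveI : BorelSpace G := ⟨rfl⟩
  haveI : SecondCountableTopology G := secondCountable_of_latticeRep r
  exact forallA_false r.continuous r.mem_unitary

end UpperOnlyC

/-! ## § Resists — why C′ itself is not killed (cycle 1), and what a kill must look like

1. **Shape of a kill.** By `femtoCurvatureTwoPointC_iff` and `UnfaithfulFalseSU.isCompactSimpleLieGroup_su`
   a refutation is EXACTLY `¬ PackageCRho r.ρ` for one faithful `r` of one `SU(n)`: for EVERY
   continuous unit map `a` and every `(Γ, β₀, ℓ₀, c, C)` a femto torus violating a clause. Since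
   `a, Γ, ℓ₀` are existential (the scheme, the shape AND the depth of the femto regime are free), a
   kill needs a TRUE, `a`-INDEPENDENT property of the amplitudes `A_L(n, β) := n⁸ Cov_{L,β}(n)` that
   no continuous reparametrisation reconciles with one `Γ`. § Running isolates the cleanest one:
   an `n`-UNIFORM freezing rate (`not_packageCRho_of_uniformDiagonalFreezing`, `…_of_bareLaw`). For
   `SU(N)` that property is false by asymptotic freedom — RG-improved perturbation theory gives
   `A_{8n}(n, β) ≈ κ ḡ⁴` with `1/ḡ² = β/2 − 2b₀ log n + …`, NOT uniformly small in `n` — so the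
   template is empty exactly where it should be. The general kill condition is: for every continuous
   `a → 0` there are arbitrarily small levels `s` whose chain values `{A_{8n}(n, β) : n a(β) = s}` have
   unbounded ratio (or touch `0`). WHAT C′ ENCODES (sharpened by card `Ideas/intrinsic-coupling-encoding.md`,
   whose `Sketch` reduction `AFStep ∧ AxisMatching ∧ PairMatching → PackageC` I accept as the right
   reading): NOT loop-exact asymptotic scaling, but asymptotic freedom as a two-sided STEP INEQUALITY —
   some intrinsic box coupling `u(L, β)` (e.g. `u² :=` the tree-normalised `A_L(L/8, β)` itself) whose
   inverse drops by an amount in `[κ₁, κ₂]`, `κ₁ > 0`, per doubling of `L` inside a perturbative window,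
   plus `O(1)` matching `A_L(n, β) ≍ u(8n, β)²`; then `a :=` the (smoothed) `u₀`-exit scale and
   `Γ(s) := (u₀^{-1/2} + κ̄ log₂(ℓ₀/8s))⁻²` witness C′, because along a chain the number of octaves between
   `8n` and the exit box is the CONSTANT `log₂(ℓ₀/8s)`. Conversely (this file) C′ forces unbounded growth
   of the amplitude in bare units along chains and `Γ(0⁺) = 0` (ForcedDividend), i.e. `Σ` of the steps
   diverges — but no per-octave lower step bound. Either way the content is entirely open
   non-perturbatively: `a`-uniform positivity and `O(1)` matching of a dimension-8 composite on the tori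
   `8n`, `n → ∞`, at couplings `β_n → ∞` (`chain_tendsto`), with a definite logarithmic growth of the box
   coupling — believed (it is the working hypothesis of finite-size step scaling, Lüscher–Weisz–Wolff
   1991; numerically two-sided around one loop wherever measured), unproved (the ultraviolet half of the
   Millennium problem WITH observables; Bałaban's running `g_k` is the only rigorous object of this kind
   and stops at effective actions). Not refutable by a refuter's means; not provable by fixed-torus
   means (§ Running: any proof must produce unbounded `β² A_{8n}(n, β)` along chains).
2. **How sharply `a` is pinned — CORRECTION of the gen-2 remark `a = a_AF · e^{O(1)}`.** `∃ a` absorbs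
   every scheme: what the chains pin is `a ≍` (the intrinsic `u₀`-exit scale) `· e^{O(1)}`, i.e.
   `log(ℓ₀/a(β)) ∈ (1/u(8, β)) · [1/κ₂, 1/κ₁]` (card point (6)). That exit scale equals
   `a₂(β) = Λ⁻¹ (b₀g₀²)^{−b₁/(2b₀²)} e^{−1/(2b₀g₀²)}` up to a bounded factor IFF two-loop asymptotic scaling
   holds — which C′ neither needs nor yields. What IS true: an EXPLICIT formula for `a` with the wrong
   exponential rate (or one-loop `a₁` against a two-loop truth, drift `(b₁/b₀) log log n` in `1/ḡ²`)
   is not a witness — the witness must track the theory's own exit scale; so a prover cannot write `a`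
   down in closed form without proving asymptotic scaling, and should DEFINE it intrinsically (card).
3. **Fixed tori carry no C′-specific information.** All fixed-`(L, n)` constraints are inherited
   (ESFB: eventual positivity, cross-torus comparability, pair/axis ratio — gen 1/2, consistent with
   the landed kernel band `[0.68, 1.81]/π²n⁴` incl. all twists, `AxisCovNonneg` (`Cov ≥ 0`, RP) and the
   MC tables j009165/j013387/j014620). C′ adds ONLY cross-`n` couplings along chains with `β_n → ∞`
   (`chain_tendsto`), invisible to any fixed-torus computation. The cheapest numerical probe is the
   planner's two-loop-matched pair `(L, β) = (16, β) ↔ (24, β′)`, `n = 2 ↦ 3`; its only failure mode (the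
   ratio `3⁸Cov₂₄(3)/2⁸Cov₁₆(2)` leaving a fixed band as `β` grows) is excluded perturbatively, and at
   accessible `β` the `O(ḡ²)` corrections and `n ≤ 3` artefacts dominate any drift — it cannot produce
   a refutation-grade witness, so no compute was spent this cycle.
4. **Strict positivity** (`Cov_{L,β}(n) > 0` on EVERY femto torus beyond `β₀`, needed by the lower
   bound with `Γ > 0`): a zero of `β ↦ Cov_{8n,β}(n)` at large `β` would kill, but `Cov ≥ 0` is landed
   (RP, `…AxisCovNonneg`) and the transfer-matrix spectral sum makes `Cov(n)` a sum of non-negative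
   terms, positive once `Var P > 0`; no attack surface.
5. **Zero modes / torons at `n ≍ L/8`, sector mixtures** (`SO(3)`, adjoint-type `r`, all `w₂` sectors
   present): the holonomy-dependent shift of `⟨P^{01}⟩_θ` is `O(g₀² L⁻⁴)` (dimension-4 composite,
   winding expansion), so `Var_θ⟨P⟩` adds at most `O(g₀⁴) · 8⁻⁸` to `n⁸Cov` at `n ≤ L/8`; constant
   non-abelian modes have `⟨|F_const|²⟩ ~ 1/(βL⁴)`; Lüscher's `g^{2/3}` toron SPECTRUM does not enhance
   plaquette covariances. Inside `[c, C]`; no kill. Lattice artefacts at `n ≤ 3`: `O(1)` kernel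
   factors, absorbed.
6. **Load-bearing summary (kernel-checked).** faithfulness of `r` (`unfaithfulC_false`);
   `ConnectedSpace G` (`nontrivialC_false`); `Γ` not floored (`no_shape_floorC`); the LOWER bound is the
   unique content even with continuity (`exists_upperOnlyCWith`); `∃ a` cannot become `∀ a`
   (`forallA_false`: slow continuous maps carry nothing); and — the C′-specific line — RUNNING:
   any `n`-uniform freezing rate, in particular the Gaussian `β⁻²` law, is fatal
   (`not_uniformDiagonalFreezing`, `not_packageCRho_of_bareLaw`), while the chains' couplings must
   diverge (`chain_tendsto`).
7. **What would still kill C′.** (i) an `n`-uniform freezing rate for `SU(N)` femto amplitudes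
   (contradicts asymptotic freedom — not expected); (ii) an `L`-non-uniformity at fixed `(n, β)` across
   femto tori `L ∈ [8n, ℓ₀/a(β)]` growing with `L` (excluded at tree level: twisted kernel band +
   `O(L⁻⁴)` zero-mode terms; `ℓ₀` existential keeps all tori deep-femto); (iii) loss of two-sidedness
   along chains from non-perturbative femto effects — only the `s → 0` end is forced (ℓ₀ free), where
   perturbation theory improves. Verdict (cycle 1): C′ is honest and open; resists because its
   content is cutoff-uniform two-sided RG-consistency (asymptotic freedom as a step inequality plus
   `O(1)` amplitude matching) of a positive dimension-8 amplitude along chains, on which nothing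
   rigorous — positive or negative — is known beyond fixed tori.
-/

end Summit.QuantumFields.YangMills.Cruxes.FemtoCurvatureTwoPointC.Disproof

end
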